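import Literature.Probability.LatticeModels.GibbsSpecification
import Literature.Probability.LatticeModels.StarLattice
import HarnessLib

/-!
# Weak and strong mixing for finite-range lattice spin systems: the Martinelli–Olivieri(–Schonmann)
# finite-size («effectiveness») statements and «weak mixing ⇒ strong mixing» in two dimensions

Topic `Literature/Probability/LatticeModels`.  Vendored STATEMENTS (named `Prop` facts, D-0014) with the
finite combinatorial vocabulary they need, for cell `ym-ir` (R350 (B1), seat lit-3; census row B2 of
`pub/ym-ir/REDUCTION-CENSUS.md` v0 — the Dobrushin–Shlosman / Martinelli–Olivieri finite-size conditions —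
whose «searchable» column had only `[bib]` entries).  SIBLING-SETTING facts: finite single-spin space,
finite-range translation-invariant interactions on `ℤ^d`; nothing here is a statement about gauge theories.

Sources (held, read this session; locators = chunk/line of the materialised texts):
* [Mar99] F. Martinelli, *Lectures on Glauber dynamics for discrete spin models*, in: Lectures on
  Probability Theory and Statistics (Saint-Flour XXVII, 1997), LNM 1717 (1999) 93–191, §2.1–2.4:
  notation p0152–p0153 (ℓ^∞ distance, cubes `Q_L(x)`, balls `B_L`, «multiple of `Q_L`», `∂_r^+ Λ`),
  Def 2.1 (finite-range translation-invariant potential, `S = {−1,+1}`) p0154 L1–12, (2.5) variation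
  distance p0156 L13–17, Def 2.3 WM / Def 2.4 SM p0157 L7–21, Thm 2.5 p0157 L35, Def 2.6 SMT + Thm 2.7 p0158
  L13–22, classes `𝓕_l`, `𝓕_l^0` p0160 L37, Prop 2.9 + Lemma 2.10 p0161 L1–16, Prop 2.11 p0163 L33–39.
  [cite: Martinelli1999]
* [MOS94] F. Martinelli, E. Olivieri, R. H. Schonmann, *For 2-D lattice spin systems weak mixing implies
  strong mixing*, Commun. Math. Phys. 165 (1994) 33–47: hypotheses H1 (finite range r), H2 (translation
  invariance), finite `S`, Gibbs measure (1.4) at inverse temperature `β > 0` p0003 L40 – p0004 L30; (1.6)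
  variation distance, (1.10) SM with `τ =_y τ′`, (1.11) WM p0004 L40 – p0005 L45; Theorem 1.1 p0005 L52–56.
  [cite: MartinelliOlivieriSchonmann1994]
* [MO94] F. Martinelli, E. Olivieri, CMP 161 (1994) 447/487 (origin of «effectiveness»; cited through
  [Mar99] Prop 2.9, «what was called in [MO1] "effectiveness"» p0158 L7–9). [cite: MartinelliOlivieri1994]

## Contents

Geometry of `ℤ^d = Site d` (ℓ^∞ metric = the tree's `supDist` of `StarLattice.lean`, [Mar99] §2.1): `finsetSupDist` (distance between finite
sets, `0` if one is empty), `rNeighbourhood`, `rOuterBoundary r Λ = ∂_r^+ Λ`, `cubeQ L x = Q_L(x)`,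
`centeredCube L = B_L = Λ_L = {‖x‖_∞ ≤ L}`, `IsMultipleOf L Λ`, the classes `𝓕_l` / `𝓕_l^0`.

Models ([MOS94] H1–H2, (1.2)–(1.5); [Mar99] Def 2.1): `FRPotential d S r` — an adapted, translation-invariant
potential of range `r` with finite single-spin space — and its finite-volume Gibbs distributions
`FRPotential.spec U β = gibbsSpecOfPotential count U (interactionSets r) β` (the tree's
`gibbsSpecOfPotential` with the counting a priori measure; `Measure.tilted` normalises).

Mixing conditions for a general specification `γ` on `Site d → S` (so that other index sets / models can
reuse them): `WeakMixing γ r Λ C m` ([Mar99] Def 2.3 = [MOS94] (1.11)), `StrongMixing γ Λ C m` ([Mar99]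
Def 2.4 in the [MOS94] (1.10) form `τ =_y τ′`), `SMT γ Λ n α` ([Mar99] Def 2.6).  Total variation on `Ω_Δ`
is rendered eventwise (`sup_{X ⊆ Ω_Δ}` = every measurable `Δ`-local event, (2.5)/(1.6)).

Named facts: `MOS1994_weakMixing_imp_strongMixing` ([MOS94] Thm 1.1 = [Mar99] Thm 2.5, `d = 2`),
`Martinelli1999_strongMixing_iff_SMT` ([Mar99] Thm 2.7), `Martinelli1999_effectiveness` ([Mar99] Prop 2.9),
`Martinelli1999_powerLaw_imp_SMT` ([Mar99] Prop 2.11) — the last three for `S = ℤˣ` (`{−1,+1}`), Martinelli's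
standing setting (p0153 «`S = {−1, 1}`»).

Proved: monotonicity of the three conditions in their constants (`WeakMixing.mono`, `StrongMixing.mono`,
`SMT.mono`), membership lemmas (`mem_rNeighbourhood`, `mem_rOuterBoundary`, `mem_centeredCube`).

## Faithfulness / design notes

* [Mar99] absorbs `β` into `J` (p0154 L14–15); [MOS94] keeps `β > 0` explicit ((1.4)).  `FRPotential.spec U β`
  keeps `β`; the [Mar99] facts quantify over all `β` (equivalently over all potentials).  [Mar99] writes the
  Hamiltonian as `−Σ_A J_A ∏_{x∈A} σ(x)` for `±1` spins; every finite-range translation-invariant adapted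
  potential on `{−1,+1}^{ℤ^d}` has this form (products of spins span the functions of finitely many spins), so
  `FRPotential d ℤˣ r` is exactly his class; the constants of Prop 2.9 depend on `(d, r, α, ‖J‖)` in print —
  typed in the weakest faithful form «for every potential and every `α` there exist `l̄, γ₁, m̂`».
* SM: [Mar99] Def 2.4 compares `τ` with the spin flip `τ^y`; for `|S| = 2` this is [MOS94] (1.10)'s
  `sup` over pairs `τ =_y τ′` (equal off `y`), which is the form typed (general finite `S`).  «every site
  `y ∈ V^c`» as printed (only `y ∈ ∂_r^+ V` matter).
* WM right-hand side `C Σ_{x ∈ Δ, y ∈ ∂_r^+ V} e^{−m d(x,y)}` with `d` = ℓ^∞ distance ([Mar99] p0152: `|x| =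
  max_i |x_i|`; [MOS94] uses its own norm `‖·‖` on `ℤ^d` — for Thm 1.1 the choice only changes constants, and we
  use ℓ^∞ throughout, flagged here).
* SMT: «local `f, g` with `d(Λ_f, Λ_g) ≥ n`», `Λ_f` the minimal dependence set.  Typed with ARBITRARY finite
  dependence sets `Λf ⊇ Λ_f`, `Λg ⊇ Λ_g` and sup-norm bounds `Bf ≥ ‖f‖_∞`, `Bg ≥ ‖g‖_∞`; since the printed
  right-hand side `|Λ_f||Λ_g|‖f‖‖g‖e^{−α d(Λ_f,Λ_g)}` is monotone under enlarging the sets / the norms and the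
  minimal sets are admissible choices, the typed condition is EQUIVALENT to the printed one.
* Thm 2.7 / Prop 2.9 / Prop 2.11 quantify over «all `Λ` multiple of `Q_{L₀}`» ([Mar99] p0153: a union of
  finitely many cubes `Q_L(x_i + y)`, `x_i ∈ Lℤ^d`, common offset `y ∈ Q_L`) — `IsMultipleOf`; `𝓕_l^0 =
  {V ∈ 𝓕_l : V ⊆ B_{2l}}` (p0160 L37).  «positive integers `l̄, γ₁`», `m̂ > 0`; «`l/2`» is the real number.
* NOT vendored: [Mar99] Lemma 2.8/2.10, Prop 2.12 (technical, model-internal quantities `h_x = e^{−∇_x H}`);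
  [MOS94] Thm 3.1 (= Dobrushin–Shlosman 1985, condition `DSU_ρ(Λ₀, δ)`) and Thm 3.2 (2-D equivalences with
  spectral gap / log-Sobolev of the Glauber dynamics) — the held scan of (3.3)–(3.4) is not legible enough to
  transcribe the condition; the tree PROVES Dobrushin–Shlosman's window comparison in the Vasserstein form
  (`DobrushinShlosman.abs_integral_sub_integral_le_of_window`, `…subsingleton_gibbsMeasures_of_window`).
* Library fit.  USED: `Site`, `Specification`, `Potential`, `Potential.IsAdapted`, `gibbsSpecOfPotential`
  (`GibbsSpecification.lean`, `LatticeGraph.lean`), `supDist` (`StarLattice.lean`); Mathlib `Fintype.piFinset`, `Measure.count`,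
  `Measure.real`, `DependsOn`.  The tree's `box d L` (`ThermodynamicLimit.lean`) is the centred cube; we keep a
  local `centeredCube` with its membership lemma to avoid importing the thermodynamic-limit layer, and relate
  nothing to it.  No overlap with `DobrushinShlosman*.lean` (those are theorems in Kantorovich form for window
  specifications; here: the discrete-spin TV mixing CONDITIONS of [MO94]/[MOS94]/[Mar99] and their printed
  implications as facts).
-/

open MeasureTheory Finset

noncomputable section

namespace Literature.Probability.LatticeModels

universe v

variable {d : ℕ} {S : Type v} [MeasurableSpace S]

/-! ### ℓ^∞ geometry of `ℤ^d` ([Mar99] §2.1) -/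

/- The ℓ^∞ distance `supDist x y = max_i |x_i − y_i|` ([Mar99] §2.1 p0152) is the tree's
`Literature.Probability.LatticeModels.supDist` (`StarLattice.lean`, with `supDist_le_iff`, `supDist_comm`,
`supDist_self`); it is reused, not redefined. -/

/-- The ℓ^∞ distance between two finite sets, `d(A,B) = min_{x∈A, y∈B} d(x,y)`; `0` if one of them is empty
(only used under a lower-bound hypothesis `n ≤ d(A,B)`). [cite: Martinelli1999, §2.1] -/
def finsetSupDist (A B : Finset (Site d)) : ℕ :=
  if h : (A ×ˢ B).Nonempty then (A ×ˢ B).inf' h (fun p => supDist p.1 p.2) else 0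

/-- The `r`-neighbourhood `{x | d(x, y) ≤ r}` of a site, as the cube `∏_i [y_i − r, y_i + r]`.
[cite: Martinelli1999, §2.1] -/
def rNeighbourhood (r : ℕ) (y : Site d) : Finset (Site d) :=
  Fintype.piFinset fun i => Finset.Icc (y i - r) (y i + r)

omit [MeasurableSpace S] in
/-- Membership in the `r`-neighbourhood is `d(x,y) ≤ r`. [cite: Martinelli1999, §2.1] -/
theorem mem_rNeighbourhood {r : ℕ} {x y : Site d} : x ∈ rNeighbourhood r y ↔ supDist x y ≤ r := by
  unfold rNeighbourhood
  rw [Fintype.mem_piFinset, supDist_le_iff]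
  refine forall_congr' fun i => ?_
  simp only [Finset.mem_Icc]
  omega

/-- The exterior `r`-boundary `∂_r^+ Λ = {x ∉ Λ : d(x, Λ) ≤ r}` ([Mar99] §2.1 p0153; [MOS94] (1.3)).
[cite: Martinelli1999, §2.1] -/
def rOuterBoundary (r : ℕ) (Λ : Finset (Site d)) : Finset (Site d) :=
  (Λ.biUnion fun y => rNeighbourhood r y) \ Λ

omit [MeasurableSpace S] in
/-- Membership in `∂_r^+ Λ`. [cite: Martinelli1999, §2.1] -/
theorem mem_rOuterBoundary {r : ℕ} {Λ : Finset (Site d)} {x : Site d} :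
    x ∈ rOuterBoundary r Λ ↔ x ∉ Λ ∧ ∃ y ∈ Λ, supDist x y ≤ r := by
  simp only [rOuterBoundary, mem_sdiff, mem_biUnion, mem_rNeighbourhood]
  tauto

/-- The cube `Q_L(x) = x + {0,…,L−1}^d` ([Mar99] §2.1 p0153). [cite: Martinelli1999, §2.1] -/
def cubeQ (L : ℕ) (x : Site d) : Finset (Site d) :=
  Fintype.piFinset fun i => Finset.Ico (x i) (x i + L)

/-- The centred cube `B_L = Q_{2L+1}((−L,…,−L)) = {x : ‖x‖_∞ ≤ L}` ([Mar99] §2.1 p0153; [MOS94] §3 `Λ_L`).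
[cite: Martinelli1999, §2.1] -/
def centeredCube (d L : ℕ) : Finset (Site d) :=
  Fintype.piFinset fun _ : Fin d => Finset.Icc (-(L : ℤ)) L

omit [MeasurableSpace S] in
/-- Membership in `B_L`. [cite: Martinelli1999, §2.1] -/
theorem mem_centeredCube {L : ℕ} {x : Site d} : x ∈ centeredCube d L ↔ ∀ i, -(L : ℤ) ≤ x i ∧ x i ≤ L := by
  simp [centeredCube, Fintype.mem_piFinset]

/-- `Λ` is a MULTIPLE of `Q_L`: a union of finitely many cubes `Q_L(L·x_i + y)`, `x_i ∈ ℤ^d`, with a common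
offset `y ∈ Q_L` ([Mar99] §2.1 p0153 L5–6). [cite: Martinelli1999, §2.1] -/
def IsMultipleOf (L : ℕ) (Λ : Finset (Site d)) : Prop :=
  ∃ y : Site d, (∀ i, 0 ≤ y i ∧ y i < L) ∧ ∃ I : Finset (Site d), Λ = I.biUnion fun x => cubeQ L (L • x + y)

/-- The class `𝓕_l` of all multiples of `Q_l` ([Mar99] p0160 L37). [cite: Martinelli1999, §2.4] -/
def classF (d l : ℕ) : Set (Finset (Site d)) := {Λ | IsMultipleOf l Λ}

/-- The FINITE class `𝓕_l^0 = {V ∈ 𝓕_l : V ⊆ B_{2l}}` ([Mar99] p0160 L37). [cite: Martinelli1999, §2.4] -/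
def classF0 (d l : ℕ) : Set (Finset (Site d)) := {Λ | IsMultipleOf l Λ ∧ Λ ⊆ centeredCube d (2 * l)}

/-! ### Finite-range, translation-invariant potentials with finite single-spin space -/

/-- The interaction sets of range `r` meeting `Λ`: all `X ⊆ ⋃_{y∈Λ} {d(·,y) ≤ r}` with `X ∩ Λ ≠ ∅` (every
`X` with `diam X ≤ r` meeting `Λ` is among them), the finite family over which `H_Λ` sums ([MOS94] (1.2);
[Mar99] Def 2.1 (2)). [cite: MartinelliOlivieriSchonmann1994, §1 (1.2)] -/
def interactionSets (r : ℕ) (Λ : Finset (Site d)) : Finset (Finset (Site d)) :=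
  ((Λ.biUnion fun y => rNeighbourhood r y).powerset).filter fun X => (X ∩ Λ).Nonempty

/-- A FINITE-RANGE, TRANSLATION-INVARIANT, ADAPTED potential with range `r` on `ℤ^d` ([MOS94] H1–H2 p0003
L48 – p0004 L8, «`U_X(σ) = U_X(η)` in case `σ_x = η_x` for all `x ∈ X`»; [Mar99] Def 2.1). [cite: MartinelliOlivieriSchonmann1994, §1 H1–H2] -/
structure FRPotential (d : ℕ) (S : Type v) [MeasurableSpace S] (r : ℕ) where
  /-- the interaction `X ↦ U_X`. -/
  U : Potential (Site d) S
  /-- `U_X` depends only on the spins in `X` and is measurable. -/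
  adapted : Potential.IsAdapted U
  /-- H1, finite range: `U_X = 0` if `diam X > r`. -/
  range : ∀ X : Finset (Site d), (∃ x ∈ X, ∃ y ∈ X, r < supDist x y) → U X = 0
  /-- H2, translation invariance: `U_{X+k}(σ) = U_X(σ(· + k))`. -/
  shift : ∀ (k : Site d) (X : Finset (Site d)) (σ : Site d → S),
    U (X.image fun x => x + k) σ = U X fun y => σ (y + k)

/-- The finite-volume Gibbs distributions `μ_Λ^τ` of a finite-range potential at inverse temperature `β`, as a
specification: the tree's `gibbsSpecOfPotential` with the counting a priori measure on the finite spin space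
([MOS94] (1.4)–(1.5); [Mar99] (2.1)). [cite: MartinelliOlivieriSchonmann1994, §1 (1.4)] -/
noncomputable def FRPotential.spec {r : ℕ} (U : FRPotential d S r) (β : ℝ) : Specification (Site d) S :=
  gibbsSpecOfPotential Measure.count U.U (interactionSets r) β

/-! ### Weak mixing, strong mixing, and exponential decay of covariances (SMT) -/

/-- **Weak mixing** `WM(Λ, C, m)` ([Mar99] Def 2.3 p0157 L7–13 = [MOS94] (1.11)): for every `Δ ⊆ Λ` and all
boundary conditions `τ, τ′`, `‖μ_{Λ,Δ}^τ − μ_{Λ,Δ}^{τ′}‖ ≤ C Σ_{x∈Δ, y∈∂_r^+Λ} e^{−m d(x,y)}` — total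
variation on `Ω_Δ` rendered eventwise ((2.5): `sup` over events of the spins in `Δ`). Stated for a general
specification `γ` and range `r`. [cite: Martinelli1999, Definition 2.3] -/
def WeakMixing (γ : Specification (Site d) S) (r : ℕ) (Λ : Finset (Site d)) (C m : ℝ) : Prop :=
  ∀ Δ : Finset (Site d), Δ ⊆ Λ → ∀ (τ τ' : Site d → S) (A : Set (Site d → S)), MeasurableSet A →
    DependsOn (· ∈ A) (↑Δ : Set (Site d)) →
      |(γ Λ τ).real A - (γ Λ τ').real A| ≤
        C * ∑ x ∈ Δ, ∑ y ∈ rOuterBoundary r Λ, Real.exp (-(m * (supDist x y : ℝ)))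

/-- **Strong mixing** `SM(Λ, C, m)` ([Mar99] Def 2.4 p0157 L15–21, in the [MOS94] (1.10) form): for every
`Δ ⊆ Λ`, every site `y ∉ Λ` and all `τ, τ′` that agree off `y`,
`‖μ_{Λ,Δ}^τ − μ_{Λ,Δ}^{τ′}‖ ≤ C e^{−m d(Δ, y)}`. [cite: Martinelli1999, Definition 2.4] -/
def StrongMixing (γ : Specification (Site d) S) (Λ : Finset (Site d)) (C m : ℝ) : Prop :=
  ∀ Δ : Finset (Site d), Δ ⊆ Λ → ∀ y : Site d, y ∉ Λ → ∀ (τ τ' : Site d → S), (∀ z, z ≠ y → τ z = τ' z) →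
    ∀ A : Set (Site d → S), MeasurableSet A → DependsOn (· ∈ A) (↑Δ : Set (Site d)) →
      |(γ Λ τ).real A - (γ Λ τ').real A| ≤ C * Real.exp (-(m * (finsetSupDist Δ {y} : ℝ)))

/-- **Condition `SMT(Λ, n, α)`** ([Mar99] Def 2.6 p0158 L13–17): for all local `f, g` with
`d(Λ_f, Λ_g) ≥ n`, `sup_τ |μ_Λ^τ(f; g)| ≤ |Λ_f| |Λ_g| ‖f‖_∞ ‖g‖_∞ e^{−α d(Λ_f,Λ_g)}`, typed with arbitrary
finite dependence sets and sup-norm bounds (equivalent, see the module docstring);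
`μ(f;g) = μ(fg) − μ(f)μ(g)`. [cite: Martinelli1999, Definition 2.6] -/
def SMT (γ : Specification (Site d) S) (Λ : Finset (Site d)) (n α : ℝ) : Prop :=
  ∀ (f g : (Site d → S) → ℝ) (Λf Λg : Finset (Site d)) (Bf Bg : ℝ),
    Measurable f → Measurable g → DependsOn f (↑Λf : Set (Site d)) → DependsOn g (↑Λg : Set (Site d)) →
    (∀ σ, |f σ| ≤ Bf) → (∀ σ, |g σ| ≤ Bg) → n ≤ (finsetSupDist Λf Λg : ℝ) →
    ∀ τ : Site d → S,
      |∫ σ, f σ * g σ ∂(γ Λ τ) - (∫ σ, f σ ∂(γ Λ τ)) * ∫ σ, g σ ∂(γ Λ τ)| ≤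
        (Λf.card : ℝ) * Λg.card * Bf * Bg * Real.exp (-(α * (finsetSupDist Λf Λg : ℝ)))

/-- Weak mixing is monotone in its constants. [cite: Martinelli1999, Definition 2.3] -/
theorem WeakMixing.mono {γ : Specification (Site d) S} {r : ℕ} {Λ : Finset (Site d)} {C C' m m' : ℝ}
    (h : WeakMixing γ r Λ C m) (hC : C ≤ C') (hm : m' ≤ m) (hC0 : 0 ≤ C) : WeakMixing γ r Λ C' m' := by
  intro Δ hΔ τ τ' A hA hdep
  refine (h Δ hΔ τ τ' A hA hdep).trans ?_
  have hS : ∑ x ∈ Δ, ∑ y ∈ rOuterBoundary r Λ, Real.exp (-(m * (supDist x y : ℝ))) ≤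
      ∑ x ∈ Δ, ∑ y ∈ rOuterBoundary r Λ, Real.exp (-(m' * (supDist x y : ℝ))) :=
    sum_le_sum fun x _ => sum_le_sum fun y _ =>
      Real.exp_le_exp.2 (neg_le_neg (mul_le_mul_of_nonneg_right hm (Nat.cast_nonneg _)))
  have hS0 : 0 ≤ ∑ x ∈ Δ, ∑ y ∈ rOuterBoundary r Λ, Real.exp (-(m' * (supDist x y : ℝ))) :=
    sum_nonneg fun _ _ => sum_nonneg fun _ _ => (Real.exp_pos _).le
  calc C * _ ≤ C * _ := mul_le_mul_of_nonneg_left hS hC0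
    _ ≤ C' * _ := mul_le_mul_of_nonneg_right hC hS0

/-- Strong mixing is monotone in its constants. [cite: Martinelli1999, Definition 2.4] -/
theorem StrongMixing.mono {γ : Specification (Site d) S} {Λ : Finset (Site d)} {C C' m m' : ℝ}
    (h : StrongMixing γ Λ C m) (hC : C ≤ C') (hm : m' ≤ m) (hC0 : 0 ≤ C) : StrongMixing γ Λ C' m' := by
  intro Δ hΔ y hy τ τ' hττ' A hA hdep
  refine (h Δ hΔ y hy τ τ' hττ' A hA hdep).trans ?_
  have h1 : Real.exp (-(m * (finsetSupDist Δ {y} : ℝ))) ≤ Real.exp (-(m' * (finsetSupDist Δ {y} : ℝ))) :=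
    Real.exp_le_exp.2 (neg_le_neg (mul_le_mul_of_nonneg_right hm (Nat.cast_nonneg _)))
  calc C * _ ≤ C * _ := mul_le_mul_of_nonneg_left h1 hC0
    _ ≤ C' * _ := mul_le_mul_of_nonneg_right hC (Real.exp_pos _).le

/-- `SMT(Λ, n, α)` is monotone: a larger separation threshold and a smaller rate are weaker.
[cite: Martinelli1999, Definition 2.6] -/
theorem SMT.mono {γ : Specification (Site d) S} {Λ : Finset (Site d)} {n n' α α' : ℝ}
    (h : SMT γ Λ n α) (hn : n ≤ n') (hα : α' ≤ α) : SMT γ Λ n' α' := by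
  intro f g Λf Λg Bf Bg hf hg hdf hdg hBf hBg hdist τ
  refine (h f g Λf Λg Bf Bg hf hg hdf hdg hBf hBg (hn.trans hdist) τ).trans ?_
  have hB : 0 ≤ (Λf.card : ℝ) * Λg.card * Bf * Bg :=
    mul_nonneg (mul_nonneg (mul_nonneg (Nat.cast_nonneg _) (Nat.cast_nonneg _))
      ((abs_nonneg _).trans (hBf τ))) ((abs_nonneg _).trans (hBg τ))
  exact mul_le_mul_of_nonneg_left
    (Real.exp_le_exp.2 (neg_le_neg (mul_le_mul_of_nonneg_right hα (Nat.cast_nonneg _)))) hB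

/-! ### The printed implications (named facts) -/

/-- **Weak mixing implies strong mixing on squares in two dimensions** ([MOS94] Theorem 1.1 p0005 L52–56;
[Mar99] Thm 2.5): for a finite-range, translation-invariant interaction with finite single-spin space on `ℤ²`
at inverse temperature `β > 0`, if `WM(Λ, C, γ)` holds for ALL finite `Λ ⊂ ℤ²` with the same `C, γ > 0`, then
there are `C′, γ′ > 0` with `SM(Λ_L, C′, γ′)` for every square `Λ_L = {‖x‖_∞ ≤ L}`.  Named `Prop` fact.
[cite: MartinelliOlivieriSchonmann1994, Theorem 1.1] -/
def MOS1994_weakMixing_imp_strongMixing [Fintype S] [MeasurableSingletonClass S] {r : ℕ}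
    (U : FRPotential 2 S r) : Prop :=
  ∀ β : ℝ, 0 < β → ∀ C γr : ℝ, 0 < C → 0 < γr →
    (∀ Λ : Finset (Site 2), WeakMixing (U.spec β) r Λ C γr) →
      ∃ C' γ' : ℝ, 0 < C' ∧ 0 < γ' ∧ ∀ L : ℕ, StrongMixing (U.spec β) (centeredCube 2 L) C' γ'

/-- **Strong mixing ⇔ exponential decay of finite-volume covariances** ([Mar99] Theorem 2.7 p0158 L19–22;
`S = {−1,+1}`): (i) `∃ C, m, L₀` with `SM(Λ, C, m)` for all `Λ` multiple of `Q_{L₀}` ⇔ (ii) `∃ l, m, L₀` with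
`SMT(Λ, l, m)` for all `Λ` multiple of `Q_{L₀}`.  Named `Prop` fact (positivity of `m, L₀` made explicit).
[cite: Martinelli1999, Theorem 2.7] -/
def Martinelli1999_strongMixing_iff_SMT {r : ℕ} (U : FRPotential d ℤˣ r) : Prop :=
  ∀ β : ℝ,
    (∃ (C m : ℝ) (L₀ : ℕ), 0 < m ∧ 0 < L₀ ∧ ∀ Λ ∈ classF d L₀, StrongMixing (U.spec β) Λ C m) ↔
    (∃ (l m : ℝ) (L₀ : ℕ), 0 < m ∧ 0 < L₀ ∧ ∀ Λ ∈ classF d L₀, SMT (U.spec β) Λ l m)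

/-- **Effectiveness of strong mixing** ([Mar99] Proposition 2.9 p0161 L1–3, after [MO94]; `S = {−1,+1}`):
given `α > 0` there are positive integers `l̄, γ₁` and `m̂ > 0` (depending on `d, r, α, ‖J‖`) such that if
`l > l̄` and `SMT(V, l/2, α)` holds for all `V` in the FINITE class `𝓕_l^0` (multiples of `Q_l` inside
`B_{2l}`), then `SMT(V, γ₁ l, m̂)` holds for ALL multiples `V ∈ 𝓕_l` of `Q_l`.  Named `Prop` fact.
[cite: Martinelli1999, Proposition 2.9] -/
def Martinelli1999_effectiveness {r : ℕ} (U : FRPotential d ℤˣ r) : Prop :=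
  ∀ β α : ℝ, 0 < α → ∃ (lbar γ₁ : ℕ) (mhat : ℝ), 0 < lbar ∧ 0 < γ₁ ∧ 0 < mhat ∧
    ∀ l : ℕ, lbar < l →
      (∀ V ∈ classF0 d l, SMT (U.spec β) V ((l : ℝ) / 2) α) →
        ∀ V ∈ classF d l, SMT (U.spec β) V ((γ₁ : ℝ) * l) mhat

/-- **Absence of intermediate decay rates** ([Mar99] Proposition 2.11 p0163 L33–39; `S = {−1,+1}`): if for
all multiples `V` of `Q_{L₀}` and all local `f, g` with `d(Λ_f,Λ_g) ≥ n`,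
`sup_τ |μ_V^τ(f;g)| ≤ |Λ_f||Λ_g|‖f‖‖g‖ φ(n)` with `n^{2(d−1)} φ(n) → 0`, then `SMT(V, l, m)` holds for all
multiples of `Q_{L₀}` for some `l, m > 0`.  Named `Prop` fact. [cite: Martinelli1999, Proposition 2.11] -/
def Martinelli1999_powerLaw_imp_SMT {r : ℕ} (U : FRPotential d ℤˣ r) : Prop :=
  ∀ (β : ℝ) (L₀ : ℕ) (φ : ℕ → ℝ), 0 < L₀ →
    Filter.Tendsto (fun n : ℕ => (n : ℝ) ^ (2 * (d - 1)) * φ n) Filter.atTop (nhds 0) →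
    (∀ V ∈ classF d L₀, ∀ n : ℕ, ∀ (f g : (Site d → ℤˣ) → ℝ) (Λf Λg : Finset (Site d)) (Bf Bg : ℝ),
      Measurable f → Measurable g → DependsOn f (↑Λf : Set (Site d)) → DependsOn g (↑Λg : Set (Site d)) →
      (∀ σ, |f σ| ≤ Bf) → (∀ σ, |g σ| ≤ Bg) → n ≤ finsetSupDist Λf Λg →
      ∀ τ, |∫ σ, f σ * g σ ∂(U.spec β V τ) - (∫ σ, f σ ∂(U.spec β V τ)) * ∫ σ, g σ ∂(U.spec β V τ)| ≤
        (Λf.card : ℝ) * Λg.card * Bf * Bg * φ n) →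
    ∃ (l m : ℝ), 0 < m ∧ ∀ V ∈ classF d L₀, SMT (U.spec β) V l m

end Literature.Probability.LatticeModels

end
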